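import Summits.ValiantsHypothesis.ValiantsHypothesis.Theorems.BarrierLeverAnchoredDoorHitsLowerPairsSplitFamilySmall

/-!
# Support item `AnchoredDoorHitsLowerPairs` (stmt-ValiantsHypothesis-22510), line `anchored-peeling`:
# CONJECTURE SP for all `m` — part 2: THE CORE LINEAR SYSTEM of the limit design, solved in closed form

Helper file (`--supports stmt-ValiantsHypothesis-22510`; cell valiant-natproofs, rung V4, 𝒟-side door (c); registered line
`Cruxes/AnchoredDoorHitsLowerPairs/Lines/anchored_peeling.lean` v24, registered stub `stub_splitFamilyGe3`; prover seat val-np-p1 gen 24;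
memo HOME/val-np-p1/g24/MEMO-SP-proof-valnp1-g24.md §2.4–2.5, §6 B3). Closes NO item. PURE ALGEBRA: no doors, no polynomials, no `Fin h`.

WHAT. The limit design of the split family `S_m` (memo §2.1) leads, after two eliminations, to a square linear system in the unknown coefficients of the
clique vertices `g1 P` (`P ⊆ {0..m}`, `P = ∅` is `ω`, `m` plays `a* = a_m`), of the clique edges `g2 P P'` (symmetric) and of the edges `{ω, u_t}` (`gwu t`),
indexed by index sets `P ⊆ range (m+1)`; "small" sets are the nonempty `s ⊆ range m` (`smallSets m`), "big" sets are `insert m X`. The equations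
(`CoreSys`, fields `h1 … hFX`) are exactly the row equations of the limit layout (memo §2.2–2.5) with the weights `r s` of the big vertices. THEOREM
`CoreSys.all_zero`: if the `r s` (`s` small) are nonzero and pairwise distinct, every unknown vanishes. PROOF = memo §2.4: closed forms
`γ_{st}(r_t − r_s) = 2(r_s a_s − r_t a_t)`, `4 r_t a_t = Σ_{P ⊔ P' = t} γ_{PP'}` (ordered), then induction on `|t|` over the Boolean lattice.

WHAT THIS IS NOT: nothing on crux stmt-ValiantsHypothesis-14610 or on `VP` versus `VNP`.
-/

set_option linter.dupNamespace false

namespace Summit.ValiantsHypothesis.ValiantsHypothesis.Theorems.BarrierLever.AnchoredPeeling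

namespace SplitGeneral

open Finset

/-- The small index sets at level `m`: nonempty subsets of `range m` (`= 𝒜₀`-index sets; also the `ℬ`-index sets of the independent vertices). -/
def smallSets (m : ℕ) : Finset (Finset ℕ) := (range m).powerset.filter (fun s => s ≠ ∅)

/-- Membership in `smallSets`. -/
theorem mem_smallSets {m : ℕ} {s : Finset ℕ} : s ∈ smallSets m ↔ s ⊆ range m ∧ s ≠ ∅ := by
  rw [smallSets, mem_filter, mem_powerset]

/-- The proper nonempty parts of `S` (ordered splittings `S = P ⊔ (S ∖ P)`). -/
def parts (S : Finset ℕ) : Finset (Finset ℕ) := S.powerset.filter (fun P => P ≠ ∅ ∧ P ≠ S)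

/-- Membership in `parts`. -/
theorem mem_parts {S P : Finset ℕ} : P ∈ parts S ↔ P ⊆ S ∧ P ≠ ∅ ∧ P ≠ S := by
  rw [parts, mem_filter, mem_powerset]

/-- **The core linear system of the limit design** (memo §2.2–2.5), unknowns `g1` (clique vertices, `∅ = ω`), `g2` (clique edges, symmetric),
`gwu` (edges `ω u_t`); `r` = weights of the big vertices `insert m s`. -/
structure CoreSys (m : ℕ) (r : Finset ℕ → ℂ) (g1 : Finset ℕ → ℂ) (g2 : Finset ℕ → Finset ℕ → ℂ) (gwu : Finset ℕ → ℂ) : Prop where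
  /-- `g2` is a function of unordered pairs. -/
  symm : ∀ P P', g2 P P' = g2 P' P
  /-- weights nonzero -/
  r_ne : ∀ s ∈ smallSets m, r s ≠ 0
  /-- weights pairwise distinct -/
  r_inj : ∀ s ∈ smallSets m, ∀ t ∈ smallSets m, s ≠ t → r s ≠ r t
  /-- rows `S ≠ ∅` without `α` (R1): `g1 S = −Σ_{unordered splittings} g2`, written with ordered splittings -/
  h1 : ∀ S, S ⊆ range (m + 1) → S ≠ ∅ → 2 * g1 S + ∑ P ∈ parts S, g2 P (S \ P) = 0
  /-- row `{α}` -/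
  hα : g1 ∅ + g1 {m} = 0
  /-- rows `α ⊔ t̃` -/
  hαT : ∀ t ∈ smallSets m, gwu t + g1 t + r t * g1 (insert m t) + g1 {m} = 0
  /-- rows `α ⊔ S`, `S ∉ {∅, {a*}}` -/
  hαS : ∀ S, S ⊆ range (m + 1) → S ≠ ∅ → S ≠ {m} → g2 ∅ S + g2 S {m} = 0
  /-- row `α ⊔ {a*}` -/
  hαA : g2 ∅ {m} = 0
  /-- rows `α ⊔ s ⊔ t̃` (E) -/
  hE : ∀ s ∈ smallSets m, ∀ t ∈ smallSets m, r t * g2 (insert m t) s + g2 {m} s + (if t = s then 0 else g2 s t) = 0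
  /-- rows `α ⊔ {a*} ⊔ t̃` (F∅) -/
  hF0 : ∀ t ∈ smallSets m, g1 t + g2 {m} t + r t * g2 {m} (insert m t) = 0
  /-- rows `α ⊔ (X + a*) ⊔ t̃`, `X ≠ ∅` (FX) -/
  hFX : ∀ X ∈ smallSets m, ∀ t ∈ smallSets m,
    (if t = X then 0 else r t * g2 (insert m X) (insert m t)) + g2 (insert m X) {m} + g2 (insert m X) t + (if t = X then 0 else g2 X t) = 0

namespace CoreSys

variable {m : ℕ} {r : Finset ℕ → ℂ} {g1 : Finset ℕ → ℂ} {g2 : Finset ℕ → Finset ℕ → ℂ} {gwu : Finset ℕ → ℂ}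

/-- `a s := g2 (insert m s) {m}` — the coefficient of the edge {v_{s+a*}, v_{a*}}. -/
theorem diag_eq (H : CoreSys m r g1 g2 gwu) {s : Finset ℕ} (hs : s ∈ smallSets m) :
    g2 (insert m s) s = - g2 (insert m s) {m} := by
  have h := H.hFX s hs s hs
  rw [if_pos rfl, if_pos rfl] at h
  linear_combination h

/-- `g2 {m} s = r s · a s`. -/
theorem b_eq (H : CoreSys m r g1 g2 gwu) {s : Finset ℕ} (hs : s ∈ smallSets m) :
    g2 {m} s = r s * g2 (insert m s) {m} := by
  have h := H.hE s hs s hs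
  rw [if_pos rfl, H.diag_eq hs] at h
  linear_combination h

/-- `r t · g2 (insert m t) s = −(γ_{st} + r s a s)` for `s ≠ t`. -/
theorem cross_eq (H : CoreSys m r g1 g2 gwu) {s t : Finset ℕ} (hs : s ∈ smallSets m) (ht : t ∈ smallSets m) (hst : s ≠ t) :
    r t * g2 (insert m t) s = - (g2 s t + r s * g2 (insert m s) {m}) := by
  have h := H.hE s hs t ht
  rw [if_neg (Ne.symm hst), H.b_eq hs] at h
  linear_combination h

/-- The (FX) equation for `s ≠ t`, multiplied by `r t`, in closed form. -/
theorem fx_mul (H : CoreSys m r g1 g2 gwu) {s t : Finset ℕ} (hs : s ∈ smallSets m) (ht : t ∈ smallSets m) (hst : s ≠ t) :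
    r s * r t * g2 (insert m t) (insert m s) + r t * g2 (insert m t) {m} - r s * g2 (insert m s) {m} + (r t - 1) * g2 s t = 0 := by
  have h := H.hFX t ht s hs
  rw [if_neg hst, if_neg hst] at h
  have hc := H.cross_eq hs ht hst
  have hsym := H.symm t s
  linear_combination r t * h - hc - r t * hsym

/-- **Closed form 1:** `γ_{st} (r_t − r_s) = 2 (r_s a_s − r_t a_t)`. -/
theorem gamma_eq (H : CoreSys m r g1 g2 gwu) {s t : Finset ℕ} (hs : s ∈ smallSets m) (ht : t ∈ smallSets m) (hst : s ≠ t) :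
    g2 s t * (r t - r s) = 2 * (r s * g2 (insert m s) {m} - r t * g2 (insert m t) {m}) := by
  have h1 := H.fx_mul hs ht hst
  have h2 := H.fx_mul ht hs (Ne.symm hst)
  have hsA := H.symm (insert m t) (insert m s)
  have hsg := H.symm s t
  linear_combination h1 - h2 - r s * r t * hsA - (r s - 1) * hsg

/-- `g1 t = −2 r_t a_t` on small `t`. -/
theorem g1_small_eq (H : CoreSys m r g1 g2 gwu) {t : Finset ℕ} (ht : t ∈ smallSets m) :
    g1 t = - 2 * r t * g2 (insert m t) {m} := by
  have h := H.hF0 t ht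
  rw [H.b_eq ht, H.symm {m} (insert m t)] at h
  linear_combination h

/-- **Closed form 2:** `4 r_t a_t = Σ_{P ∈ parts t} γ_{P, t∖P}`. -/
theorem four_a_eq (H : CoreSys m r g1 g2 gwu) {t : Finset ℕ} (ht : t ∈ smallSets m) :
    4 * r t * g2 (insert m t) {m} = ∑ P ∈ parts t, g2 P (t \ P) := by
  have hts := (mem_smallSets.mp ht)
  have h := H.h1 t (hts.1.trans (Finset.range_subset_range.mpr (Nat.le_succ m))) hts.2
  rw [H.g1_small_eq ht] at h
  linear_combination (-1 : ℂ) * h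

/-- Parts of a small set are small, and so are their complements. -/
theorem parts_small {t P : Finset ℕ} (ht : t ∈ smallSets m) (hP : P ∈ parts t) : P ∈ smallSets m ∧ t \ P ∈ smallSets m := by
  obtain ⟨hPt, hP0, hPne⟩ := mem_parts.mp hP
  obtain ⟨htr, _⟩ := mem_smallSets.mp ht
  refine ⟨mem_smallSets.mpr ⟨hPt.trans htr, hP0⟩, mem_smallSets.mpr ⟨Finset.sdiff_subset.trans htr, ?_⟩⟩
  intro h0
  exact hPne (Finset.Subset.antisymm hPt (Finset.sdiff_eq_empty_iff_subset.mp h0))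

/-- **Induction over the Boolean lattice: all `a_t = 0`.** -/
theorem a_zero (H : CoreSys m r g1 g2 gwu) : ∀ t ∈ smallSets m, g2 (insert m t) {m} = 0 := by
  suffices hn : ∀ n : ℕ, ∀ t ∈ smallSets m, t.card ≤ n → g2 (insert m t) {m} = 0 from fun t ht => hn t.card t ht le_rfl
  intro n
  induction n with
  | zero =>
    intro t ht hcard
    exact absurd (Finset.card_eq_zero.mp (Nat.le_zero.mp hcard)) (mem_smallSets.mp ht).2
  | succ n ih =>
    intro t ht hcard
    have hsum : ∑ P ∈ parts t, g2 P (t \ P) = 0 := by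
      refine Finset.sum_eq_zero (fun P hP => ?_)
      obtain ⟨hPs, hQs⟩ := parts_small ht hP
      obtain ⟨hPt, hP0, hPne⟩ := mem_parts.mp hP
      have hcP : P.card ≤ n := by
        have := Finset.card_lt_card (lt_of_le_of_ne hPt hPne); omega
      have hcQ : (t \ P).card ≤ n := by
        have hlt : (t \ P).card < t.card := by
          rw [Finset.card_sdiff_of_subset hPt]
          have := Finset.card_pos.mpr (Finset.nonempty_iff_ne_empty.mpr hP0)
          have hle := Finset.card_le_card hPt
          omega
        omega
      have haP := ih P hPs hcP
      have haQ := ih (t \ P) hQs hcQ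
      have hne : P ≠ t \ P := fun heq => hP0 (by
        have : P ∩ (t \ P) = ∅ := Finset.disjoint_iff_inter_eq_empty.mp Finset.disjoint_sdiff
        rwa [← heq, Finset.inter_self] at this)
      have hγ := H.gamma_eq hPs hQs hne
      rw [haP, haQ, mul_zero, mul_zero, sub_zero, mul_zero] at hγ
      have hr : r (t \ P) - r P ≠ 0 := sub_ne_zero.mpr (H.r_inj _ hQs _ hPs (Ne.symm hne))
      exact (mul_eq_zero.mp hγ).resolve_right hr
    have h4 := H.four_a_eq ht
    rw [hsum] at h4
    have hr : (4 : ℂ) * r t ≠ 0 := mul_ne_zero (by norm_num) (H.r_ne t ht)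
    exact (mul_eq_zero.mp h4).resolve_left hr

/-- `γ_{st} = 0` for distinct small `s, t`. -/
theorem gamma_zero (H : CoreSys m r g1 g2 gwu) {s t : Finset ℕ} (hs : s ∈ smallSets m) (ht : t ∈ smallSets m) (hst : s ≠ t) : g2 s t = 0 := by
  have hγ := H.gamma_eq hs ht hst
  rw [H.a_zero s hs, H.a_zero t ht, mul_zero, mul_zero, sub_zero, mul_zero] at hγ
  exact (mul_eq_zero.mp hγ).resolve_right (sub_ne_zero.mpr (H.r_inj _ ht _ hs (Ne.symm hst)))

/-- `g2 {m} s = 0`. -/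
theorem b_zero (H : CoreSys m r g1 g2 gwu) {s : Finset ℕ} (hs : s ∈ smallSets m) : g2 {m} s = 0 := by
  rw [H.b_eq hs, H.a_zero s hs, mul_zero]

/-- `g2 (insert m t) s = 0` for small `s, t` (equal or not). -/
theorem cross_zero (H : CoreSys m r g1 g2 gwu) {s t : Finset ℕ} (hs : s ∈ smallSets m) (ht : t ∈ smallSets m) : g2 (insert m t) s = 0 := by
  by_cases hst : s = t
  · subst hst; rw [H.diag_eq hs, H.a_zero s hs, neg_zero]
  · have h := H.cross_eq hs ht hst
    rw [H.gamma_zero hs ht hst, H.a_zero s hs, mul_zero, add_zero, neg_zero] at h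
    exact (mul_eq_zero.mp h).resolve_left (H.r_ne t ht)

/-- `g2 (insert m t) (insert m s) = 0` for distinct small `s, t`. -/
theorem bigbig_zero (H : CoreSys m r g1 g2 gwu) {s t : Finset ℕ} (hs : s ∈ smallSets m) (ht : t ∈ smallSets m) (hst : s ≠ t) :
    g2 (insert m t) (insert m s) = 0 := by
  have h := H.fx_mul hs ht hst
  rw [H.a_zero s hs, H.a_zero t ht, H.gamma_zero hs ht hst, mul_zero, mul_zero, mul_zero, add_zero, sub_zero, add_zero] at h
  exact (mul_eq_zero.mp h).resolve_left (mul_ne_zero (H.r_ne s hs) (H.r_ne t ht))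

/-- `g1 t = 0` on small `t`. -/
theorem g1_small_zero (H : CoreSys m r g1 g2 gwu) {t : Finset ℕ} (ht : t ∈ smallSets m) : g1 t = 0 := by
  rw [H.g1_small_eq ht, H.a_zero t ht, mul_zero]

/-- Classification of index sets `P ⊆ range (m+1)`: `∅`, `{m}`, small, or `insert m s` with `s` small. -/
theorem classify {P : Finset ℕ} (hP : P ⊆ range (m + 1)) :
    P = ∅ ∨ P = {m} ∨ P ∈ smallSets m ∨ (P.erase m ∈ smallSets m ∧ P = insert m (P.erase m)) := by
  by_cases hm : m ∈ P
  · by_cases he : P.erase m = ∅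
    · right; left
      rw [← Finset.insert_erase hm, he]; rfl
    · right; right; right
      refine ⟨mem_smallSets.mpr ⟨fun x hx => ?_, he⟩, (Finset.insert_erase hm).symm⟩
      have hx' := Finset.mem_erase.mp hx
      have := Finset.mem_range.mp (hP hx'.2)
      exact Finset.mem_range.mpr (by omega)
  · by_cases he : P = ∅
    · left; exact he
    · right; right; left
      refine mem_smallSets.mpr ⟨fun x hx => ?_, he⟩
      have := Finset.mem_range.mp (hP hx)
      have hxm : x ≠ m := fun hxm => hm (hxm ▸ hx)
      exact Finset.mem_range.mpr (by omega)

/-- `g2 P P' = 0` whenever one of `P, P'` is small or `{m}` or big and the other is small/`{m}`/big, `P ≠ P'` (everything except the `∅` cases). -/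
theorem g2_zero_of_ne_empty (H : CoreSys m r g1 g2 gwu) {P P' : Finset ℕ} (hP : P ⊆ range (m + 1)) (hP' : P' ⊆ range (m + 1))
    (hP0 : P ≠ ∅) (hP'0 : P' ≠ ∅) (hne : P ≠ P') : g2 P P' = 0 := by
  rcases classify hP with h0 | hA | hS | ⟨hS, hins⟩
  · exact absurd h0 hP0
  · rcases classify hP' with h0' | hA' | hS' | ⟨hS', hins'⟩
    · exact absurd h0' hP'0
    · exact absurd (hA.trans hA'.symm) hne
    · rw [hA]; exact H.b_zero hS'
    · rw [hA, hins', H.symm]; exact H.a_zero _ hS'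
  · rcases classify hP' with h0' | hA' | hS' | ⟨hS', hins'⟩
    · exact absurd h0' hP'0
    · rw [hA', H.symm]; exact H.b_zero hS
    · exact H.gamma_zero hS hS' (fun h => hne h)
    · rw [hins', H.symm]; exact H.cross_zero hS hS'
  · rcases classify hP' with h0' | hA' | hS' | ⟨hS', hins'⟩
    · exact absurd h0' hP'0
    · rw [hins, hA']; exact H.a_zero _ hS
    · rw [hins]; exact H.cross_zero hS' hS
    · rw [hins, hins']
      refine H.bigbig_zero hS' hS (fun heq => hne ?_)
      rw [hins, hins', heq]

/-- `g1` vanishes on big sets `insert m X`, `X ⊆ range m` (from (R1) on big rows, all splittings having vanishing `g2`). -/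
theorem g1_big_zero (H : CoreSys m r g1 g2 gwu) {X : Finset ℕ} (hX : X ⊆ range m) : g1 (insert m X) = 0 := by
  have hS : insert m X ⊆ range (m + 1) := by
    intro x hx
    rcases Finset.mem_insert.mp hx with rfl | hx
    · exact Finset.mem_range.mpr (Nat.lt_succ_self _)
    · exact Finset.mem_range.mpr (Nat.lt_succ_of_lt (Finset.mem_range.mp (hX hx)))
  have h := H.h1 (insert m X) hS (Finset.insert_ne_empty _ _)
  have hsum : ∑ P ∈ parts (insert m X), g2 P (insert m X \ P) = 0 := by
    refine Finset.sum_eq_zero (fun P hP => ?_)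
    obtain ⟨hPS, hP0, hPne⟩ := mem_parts.mp hP
    refine H.g2_zero_of_ne_empty (hPS.trans hS) (Finset.sdiff_subset.trans hS) hP0 ?_ ?_
    · intro h0; exact hPne (Finset.Subset.antisymm hPS (Finset.sdiff_eq_empty_iff_subset.mp h0))
    · intro heq
      have : P ∩ (insert m X \ P) = P := by rw [← heq, Finset.inter_self]
      rw [Finset.inter_sdiff_self] at this
      exact hP0 this.symm
  rw [hsum, add_zero] at h
  exact (mul_eq_zero.mp h).resolve_left two_ne_zero

/-- **THE CORE THEOREM: every unknown of the core system vanishes.** -/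
theorem all_zero (H : CoreSys m r g1 g2 gwu) :
    (∀ P, P ⊆ range (m + 1) → g1 P = 0) ∧ (∀ P P', P ⊆ range (m + 1) → P' ⊆ range (m + 1) → P ≠ P' → g2 P P' = 0) ∧
      (∀ t ∈ smallSets m, gwu t = 0) := by
  have hA0 : g1 {m} = 0 := by
    have := H.g1_big_zero (Finset.empty_subset (range m))
    rwa [show insert m (∅ : Finset ℕ) = {m} from rfl] at this
  have h1all : ∀ P, P ⊆ range (m + 1) → g1 P = 0 := by
    intro P hP
    rcases classify hP with h0 | hA | hS | ⟨hS, hins⟩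
    · rw [h0]; have h := H.hα; rw [hA0, add_zero] at h; exact h
    · rw [hA]; exact hA0
    · exact H.g1_small_zero hS
    · rw [hins]; exact H.g1_big_zero (mem_smallSets.mp hS).1
  have h2empty : ∀ S, S ⊆ range (m + 1) → S ≠ ∅ → g2 ∅ S = 0 := by
    intro S hS hS0
    by_cases hSA : S = {m}
    · rw [hSA]; exact H.hαA
    · have h := H.hαS S hS hS0 hSA
      have hz : g2 S {m} = 0 :=
        H.g2_zero_of_ne_empty hS (Finset.singleton_subset_iff.mpr (Finset.mem_range.mpr (Nat.lt_succ_self m))) hS0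
          (Finset.singleton_ne_empty m) hSA
      rw [hz, add_zero] at h; exact h
  refine ⟨h1all, fun P P' hP hP' hne => ?_, fun t ht => ?_⟩
  · by_cases hP0 : P = ∅
    · subst hP0; exact h2empty P' hP' (Ne.symm hne)
    · by_cases hP'0 : P' = ∅
      · subst hP'0; rw [H.symm]; exact h2empty P hP hne
      · exact H.g2_zero_of_ne_empty hP hP' hP0 hP'0 hne
  · have h := H.hαT t ht
    have hts := mem_smallSets.mp ht
    rw [H.g1_small_zero ht, H.g1_big_zero hts.1, hA0, mul_zero, add_zero, add_zero, add_zero] at h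
    exact h

end CoreSys

end SplitGeneral

end Summit.ValiantsHypothesis.ValiantsHypothesis.Theorems.BarrierLever.AnchoredPeeling
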